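import Literature.MathematicalPhysics.QuantumLattice.LiebWuShibaEquation
import Literature.MathematicalPhysics.QuantumLattice.LiebWuEnergyAtFillingBracket
import HarnessLib

/-!
# A-posteriori (residual) bound for Shiba's equation (2.8): what a certified evaluation of
# Lieb–Wu's (13)–(17) at `B = ∞` has to supply

Family `hubbard`. Shiba, PRB 6 (1972) 930, §II eq. (2.8) [Shiba1972PRB] (= Essler et al. 2005 (5.105)): at
`B = ∞` the Lieb–Wu momentum density with cutoff `Q` solves the single second-kind Fredholm equation
`ρ(k) = 1/2π + cos k ∫_{-Q}^{Q} R(sin k - sin k') ρ(k') dk'`, `R = fermiKernel (U/4)`, `0 ≤ R ≤ 2/(πU)`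
(`fermiKernel_le`); in the tree `ρ = ρ_Q = liebWuRhoAt U Q` (`liebWuRhoAt_eq_shiba`), and the solution is
unique (Lieb–Wu, Physica A 321 (2003) 1, §5, Theorem 1: the operator `1 - Û…` is inverted by a convergent
series; tree: `LiebWuNeumannSeries`, `eq_liebWuRhoAt_of_shiba`) [LiebWuPhysicaA2003].

This file records the QUANTITATIVE form of that uniqueness in the supremum norm on `[-Q, Q]`, under the
smallness condition `λ := 4Q/(πU) < 1`: the integral operator `(Aφ)(k) = cos k ∫_{-Q}^{Q} R(sin k - sin k') φ(k') dk'`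
on `C[-Q, Q]` has `‖A‖_∞ = max_k ∫ |cos k R(sin k - sin k')| dk' ≤ 2Q · 2/(πU) = λ` (Kress, *Linear Integral
Equations* (1999), Theorem 2.13), so `‖(I - A)⁻¹‖_∞ ≤ 1/(1 - λ)` (Neumann series, Kress Theorem 2.14), and a residual
`r = ρ̃ - 1/2π - Aρ̃` of an approximate solution controls its error, `ρ_Q - ρ̃ = -(I - A)⁻¹ r` [Kress1999]. Concretely
(proved here from scratch by a maximum argument, no operator theory): if a function `ρ̃`, continuous on `[-Q, Q]`,
satisfies (2.8) up to a residual `|ρ̃(k) - 1/2π - cos k ∫_{-Q}^{Q} R(sin k - sin k') ρ̃(k') dk'| ≤ ε` on `[-Q, Q]`, then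

* `abs_liebWuRhoAt_sub_le_of_residual` — `|ρ_Q(k) - ρ̃(k)| ≤ ε/(1 - λ)` on `[-Q, Q]`;
* `abs_liebWuFillingAtCutoff_sub_le_of_residual` — `|N/N_a(Q) - ∫_{-Q}^{Q} ρ̃| ≤ 2Qε/(1 - λ)` (eq. (15));
* `abs_liebWuEnergyAtCutoff_sub_le_of_residual` — `|E/N_a(Q) + 2∫_{-Q}^{Q} ρ̃ cos k| ≤ 4Qε/(1 - λ)` (eq. (17)).

These are exactly the hypotheses `N/N_a(Q₁) ≤ n ≤ N/N_a(Q₂)`, `e(Q₁) ∈ [a, b]` that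
`LiebWuEnergyAtFillingBracket` turns into a two-sided statement about `liebWuEnergyAtFilling U n`
(`liebWuEnergyAtFilling_mem_Icc_of_residual` below packages the two steps). Nothing here is a numerical
claim; `λ < 1` holds for every `Q ≤ π` when `U > 4` and for `Q < πU/4` in general. No named fact.

## References

* H. Shiba, Phys. Rev. B 6 (1972) 930, §II, eqs. (2.3), (2.5), (2.8) [Shiba1972PRB].
* E. H. Lieb, F. Y. Wu, Physica A 321 (2003) 1 = arXiv:cond-mat/0207529, §5, Theorem 1 and eq. (U)
  (uniqueness by inversion of `1 + K̂²`, positivity and the bound on the kernel of `Û`) [LiebWuPhysicaA2003].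
* E. H. Lieb, F. Y. Wu, Phys. Rev. Lett. 20 (1968) 1445, eqs. (15), (17) [LiebWuPRL1968].
* R. Kress, *Linear Integral Equations*, 2nd ed., Applied Mathematical Sciences 82, Springer (1999), §2.3
  Theorem 2.13 (norm of an integral operator with continuous kernel on `C(G)`), §2.4 Theorem 2.14 (Neumann series,
  `‖(I - A)⁻¹‖ ≤ 1/(1 - ‖A‖)`) [Kress1999].
-/

noncomputable section

open MeasureTheory Set Real Filter intervalIntegral
open Literature.Analysis.SpecialFunctions

namespace Literature.MathematicalPhysics.QuantumLattice

section Residual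

variable {U Q ε : ℝ} {ρa : ℝ → ℝ}

/-- **Residual bound for (2.8) in the sup norm.** `U > 0`, `0 < Q ≤ π`, `4Q < πU`; if `ρ̃` is continuous on
`[-Q, Q]` and `|ρ̃(k) - 1/2π - cos k ∫_{-Q}^{Q} fermiKernel (U/4) (sin k - sin k') ρ̃(k') dk'| ≤ ε` for
`k ∈ [-Q, Q]`, then `|ρ_Q(k) - ρ̃(k)| ≤ ε / (1 - 4Q/(πU))` on `[-Q, Q]` (the difference `d = ρ_Q - ρ̃` satisfies
`d = cos k ∫ R d - r` with `|∫_{-Q}^{Q} R d| ≤ (4Q/(πU)) sup|d|`, since `0 ≤ R ≤ 2/(πU)`; i.e. the residual bound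
`‖d‖_∞ ≤ ‖(I - A)⁻¹‖_∞ ‖r‖_∞ ≤ ‖r‖_∞/(1 - ‖A‖_∞)` of the Neumann-series theorem for this kernel).
[cite: Kress1999, Theorems 2.13 and 2.14] [cite: LiebWuPhysicaA2003, §5, Theorem 1] [cite: Shiba1972PRB, §II, eq. (2.8)] -/
theorem abs_liebWuRhoAt_sub_le_of_residual (hU : 0 < U) (hQ : 0 < Q) (hQπ : Q ≤ π) (hlam : 4 * Q < π * U)
    (hρa : ContinuousOn ρa (Icc (-Q) Q))
    (hres : ∀ k ∈ Icc (-Q) Q, |ρa k - 1 / (2 * π) -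
      Real.cos k * ∫ k' in -Q..Q, fermiKernel (U / 4) (Real.sin k - Real.sin k') * ρa k'| ≤ ε)
    {k : ℝ} (hk : k ∈ Icc (-Q) Q) :
    |liebWuRhoAt U Q k - ρa k| ≤ ε / (1 - 4 * Q / (π * U)) := by
  have hπ := Real.pi_pos
  have hc : 0 < U / 4 := by positivity
  have hQQ : -Q ≤ Q := by linarith
  set ρ := liebWuRhoAt U Q with hρdef
  set lam : ℝ := 4 * Q / (π * U) with hlamdef
  have hlam1 : lam < 1 := by rw [hlamdef, div_lt_one (by positivity)]; linarith
  have hρc : Continuous ρ := continuous_liebWuRhoAt hU hQ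
  -- the difference and its maximum on `[-Q, Q]`
  set d : ℝ → ℝ := fun k => ρ k - ρa k with hd
  have hdc : ContinuousOn d (Icc (-Q) Q) := hρc.continuousOn.sub hρa
  have hdabs : ContinuousOn (fun k => |d k|) (Icc (-Q) Q) := hdc.abs
  obtain ⟨k₀, hk₀, hmax⟩ := (isCompact_Icc (a := -Q) (b := Q)).exists_isMaxOn
    (nonempty_Icc.2 hQQ) hdabs
  set M := |d k₀| with hM
  have hMk : ∀ k ∈ Icc (-Q) Q, |d k| ≤ M := fun k hk => hmax hk
  have hM0 : 0 ≤ M := abs_nonneg _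
  -- kernel facts
  have hRc : ∀ k, Continuous fun k' => fermiKernel (U / 4) (Real.sin k - Real.sin k') := fun k =>
    (continuous_fermiKernel hc).comp (continuous_const.sub Real.continuous_sin)
  have hRle : ∀ x, |fermiKernel (U / 4) x| ≤ 2 / (π * U) := fun x => by
    rw [abs_of_nonneg (fermiKernel_nonneg hc x)]
    calc fermiKernel (U / 4) x ≤ 1 / (2 * π * (U / 4)) := fermiKernel_le hc x
      _ = 2 / (π * U) := by field_simp; ring
  -- the key pointwise estimate `|d k| ≤ lam * M + ε` on `[-Q, Q]`
  have hkey : ∀ k ∈ Icc (-Q) Q, |d k| ≤ lam * M + ε := by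
    intro k hk
    have hρk := liebWuRhoAt_eq_shiba hU hQ hQπ k
    rw [← hρdef] at hρk
    have hrk := hres k hk
    have hiρ : IntervalIntegrable (fun k' => fermiKernel (U / 4) (Real.sin k - Real.sin k') * ρ k')
        volume (-Q) Q := ((hRc k).mul hρc).intervalIntegrable _ _
    have hiρa : IntervalIntegrable (fun k' => fermiKernel (U / 4) (Real.sin k - Real.sin k') * ρa k')
        volume (-Q) Q := by
      refine ContinuousOn.intervalIntegrable ?_
      rw [uIcc_of_le hQQ]
      exact (hRc k).continuousOn.mul hρa
    have hsub : (∫ k' in -Q..Q, fermiKernel (U / 4) (Real.sin k - Real.sin k') * ρ k') -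
        (∫ k' in -Q..Q, fermiKernel (U / 4) (Real.sin k - Real.sin k') * ρa k') =
        ∫ k' in -Q..Q, fermiKernel (U / 4) (Real.sin k - Real.sin k') * d k' := by
      rw [← intervalIntegral.integral_sub hiρ hiρa]
      refine intervalIntegral.integral_congr fun k' _ => ?_
      simp only [hd]
      ring
    have hId : |∫ k' in -Q..Q, fermiKernel (U / 4) (Real.sin k - Real.sin k') * d k'| ≤ lam * M := by
      have h := intervalIntegral.norm_integral_le_of_norm_le_const (a := -Q) (b := Q) (C := 2 / (π * U) * M)
        (f := fun k' => fermiKernel (U / 4) (Real.sin k - Real.sin k') * d k') fun k' hk' => by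
          rw [uIoc_of_le hQQ] at hk'
          rw [Real.norm_eq_abs, abs_mul]
          exact mul_le_mul (hRle _) (hMk k' (Ioc_subset_Icc_self hk')) (abs_nonneg _) (by positivity)
      rw [Real.norm_eq_abs, show Q - -Q = 2 * Q by ring, abs_of_pos (by positivity : (0 : ℝ) < 2 * Q)] at h
      refine h.trans (le_of_eq ?_)
      rw [hlamdef]; field_simp; ring
    -- `d k = cos k * ∫ R d - residual`
    have e : d k = Real.cos k * (∫ k' in -Q..Q, fermiKernel (U / 4) (Real.sin k - Real.sin k') * d k') -
        (ρa k - 1 / (2 * π) -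
          Real.cos k * ∫ k' in -Q..Q, fermiKernel (U / 4) (Real.sin k - Real.sin k') * ρa k') := by
      rw [← hsub]
      simp only [hd]
      rw [hρk]
      ring
    rw [e]
    refine (abs_sub _ _).trans (add_le_add ?_ hrk)
    rw [abs_mul]
    calc |Real.cos k| * |∫ k' in -Q..Q, fermiKernel (U / 4) (Real.sin k - Real.sin k') * d k'|
        ≤ 1 * (lam * M) := mul_le_mul (Real.abs_cos_le_one k) hId (abs_nonneg _) zero_le_one
      _ = lam * M := one_mul _
  -- at the maximum: `M ≤ lam * M + ε`, hence `M ≤ ε/(1 - lam)`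
  have hMle : M ≤ ε / (1 - lam) := by
    have h := hkey k₀ hk₀
    rw [← hM] at h
    rw [le_div_iff₀ (by linarith)]
    nlinarith
  exact (hMk k hk).trans hMle

/-- **Eq. (15) from a residual certificate:** `|N/N_a(Q) - ∫_{-Q}^{Q} ρ̃| ≤ 2Q · ε/(1 - 4Q/(πU))`.
[cite: LiebWuPRL1968, eq. (15)] [cite: Shiba1972PRB, §II, eqs. (2.3), (2.8)] -/
theorem abs_liebWuFillingAtCutoff_sub_le_of_residual (hU : 0 < U) (hQ : 0 < Q) (hQπ : Q ≤ π)
    (hlam : 4 * Q < π * U) (hρa : ContinuousOn ρa (Icc (-Q) Q))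
    (hres : ∀ k ∈ Icc (-Q) Q, |ρa k - 1 / (2 * π) -
      Real.cos k * ∫ k' in -Q..Q, fermiKernel (U / 4) (Real.sin k - Real.sin k') * ρa k'| ≤ ε) :
    |liebWuFillingAtCutoff U Q - ∫ k in -Q..Q, ρa k| ≤ 2 * Q * (ε / (1 - 4 * Q / (π * U))) := by
  have hQQ : -Q ≤ Q := by linarith
  have hρc : Continuous (liebWuRhoAt U Q) := continuous_liebWuRhoAt hU hQ
  have hiρa : IntervalIntegrable ρa volume (-Q) Q :=
    ContinuousOn.intervalIntegrable (by rwa [uIcc_of_le hQQ])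
  rw [liebWuFillingAtCutoff, liebWuFilling_eq, ← intervalIntegral.integral_sub (hρc.intervalIntegrable _ _) hiρa]
  have h := intervalIntegral.norm_integral_le_of_norm_le_const (a := -Q) (b := Q)
    (C := ε / (1 - 4 * Q / (π * U))) (f := fun k => liebWuRhoAt U Q k - ρa k) fun k hk => by
      rw [uIoc_of_le hQQ] at hk
      rw [Real.norm_eq_abs]
      exact abs_liebWuRhoAt_sub_le_of_residual hU hQ hQπ hlam hρa hres (Ioc_subset_Icc_self hk)
  rw [Real.norm_eq_abs, show Q - -Q = 2 * Q by ring, abs_of_pos (by positivity : (0 : ℝ) < 2 * Q)] at h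
  linarith

/-- **Eq. (17) from a residual certificate:** `|E/N_a(Q) - (-2∫_{-Q}^{Q} ρ̃ cos k)| ≤ 4Q · ε/(1 - 4Q/(πU))`.
[cite: LiebWuPRL1968, eq. (17)] [cite: Shiba1972PRB, §II, eqs. (2.5), (2.8)] -/
theorem abs_liebWuEnergyAtCutoff_sub_le_of_residual (hU : 0 < U) (hQ : 0 < Q) (hQπ : Q ≤ π)
    (hlam : 4 * Q < π * U) (hρa : ContinuousOn ρa (Icc (-Q) Q))
    (hres : ∀ k ∈ Icc (-Q) Q, |ρa k - 1 / (2 * π) -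
      Real.cos k * ∫ k' in -Q..Q, fermiKernel (U / 4) (Real.sin k - Real.sin k') * ρa k'| ≤ ε) :
    |liebWuEnergyAtCutoff U Q - (-2 * ∫ k in -Q..Q, ρa k * Real.cos k)| ≤
      4 * Q * (ε / (1 - 4 * Q / (π * U))) := by
  have hQQ : -Q ≤ Q := by linarith
  have hρc : Continuous (liebWuRhoAt U Q) := continuous_liebWuRhoAt hU hQ
  have hiρa : IntervalIntegrable (fun k => ρa k * Real.cos k) volume (-Q) Q := by
    refine ContinuousOn.intervalIntegrable ?_
    rw [uIcc_of_le hQQ]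
    exact hρa.mul Real.continuous_cos.continuousOn
  have hiρ : IntervalIntegrable (fun k => liebWuRhoAt U Q k * Real.cos k) volume (-Q) Q :=
    (hρc.mul Real.continuous_cos).intervalIntegrable _ _
  rw [liebWuEnergyAtCutoff, liebWuEnergyPerSite_eq,
    show -2 * (∫ k in -Q..Q, liebWuRhoAt U Q k * Real.cos k) - -2 * ∫ k in -Q..Q, ρa k * Real.cos k =
      -2 * ((∫ k in -Q..Q, liebWuRhoAt U Q k * Real.cos k) - ∫ k in -Q..Q, ρa k * Real.cos k) by ring,
    ← intervalIntegral.integral_sub hiρ hiρa, abs_mul, abs_neg, abs_two]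
  have h := intervalIntegral.norm_integral_le_of_norm_le_const (a := -Q) (b := Q)
    (C := ε / (1 - 4 * Q / (π * U))) (f := fun k => liebWuRhoAt U Q k * Real.cos k - ρa k * Real.cos k)
    fun k hk => by
      rw [uIoc_of_le hQQ] at hk
      rw [Real.norm_eq_abs, ← sub_mul, abs_mul]
      calc |liebWuRhoAt U Q k - ρa k| * |Real.cos k| ≤ ε / (1 - 4 * Q / (π * U)) * 1 :=
            mul_le_mul (abs_liebWuRhoAt_sub_le_of_residual hU hQ hQπ hlam hρa hres (Ioc_subset_Icc_self hk))
              (Real.abs_cos_le_one k) (abs_nonneg _)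
              ((abs_nonneg _).trans
                (abs_liebWuRhoAt_sub_le_of_residual hU hQ hQπ hlam hρa hres (Ioc_subset_Icc_self hk)))
        _ = ε / (1 - 4 * Q / (π * U)) := mul_one _
  rw [Real.norm_eq_abs, show Q - -Q = 2 * Q by ring, abs_of_pos (by positivity : (0 : ℝ) < 2 * Q)] at h
  linarith

end Residual

section Density

variable {U Q₁ Q₂ n ε₁ ε₂ : ℝ} {ρ₁ ρ₂ : ℝ → ℝ}

/-- **The Lieb–Wu energy at density `n` from two residual certificates.** If `ρ̃₁`, `ρ̃₂` are continuous
approximate solutions of (2.8) at cutoffs `0 < Q₁ ≤ Q₂ ≤ π` (`4Q₂ < πU`) with sup-residuals `ε₁`, `ε₂`, and the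
certified fillings bracket `n` — `∫ρ̃₁ + 2Q₁ε₁/(1-λ₁) ≤ n ≤ ∫ρ̃₂ - 2Q₂ε₂/(1-λ₂)`, `λᵢ = 4Qᵢ/(πU)` — then
`|liebWuEnergyAtFilling U n - (-2∫_{-Q₁}^{Q₁} ρ̃₁ cos k)| ≤ 4Q₁ε₁/(1-λ₁) + (2/π)(1 + 8/U)²(Q₂ - Q₁)`
(residual bounds above + `liebWuEnergyAtFilling_mem_Icc_of_bracket`).
[cite: LiebWuPRL1968, eqs. (15), (17)] [cite: LiebWuPhysicaA2003, §5, Theorems 1 and 3] -/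
theorem abs_liebWuEnergyAtFilling_sub_le_of_residual (hU : 0 < U) (hQ₁ : 0 < Q₁) (hQ₁₂ : Q₁ ≤ Q₂)
    (hQ₂ : Q₂ ≤ π) (hlam : 4 * Q₂ < π * U)
    (hρ₁ : ContinuousOn ρ₁ (Icc (-Q₁) Q₁)) (hρ₂ : ContinuousOn ρ₂ (Icc (-Q₂) Q₂))
    (hres₁ : ∀ k ∈ Icc (-Q₁) Q₁, |ρ₁ k - 1 / (2 * π) -
      Real.cos k * ∫ k' in -Q₁..Q₁, fermiKernel (U / 4) (Real.sin k - Real.sin k') * ρ₁ k'| ≤ ε₁)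
    (hres₂ : ∀ k ∈ Icc (-Q₂) Q₂, |ρ₂ k - 1 / (2 * π) -
      Real.cos k * ∫ k' in -Q₂..Q₂, fermiKernel (U / 4) (Real.sin k - Real.sin k') * ρ₂ k'| ≤ ε₂)
    (hn₁ : (∫ k in -Q₁..Q₁, ρ₁ k) + 2 * Q₁ * (ε₁ / (1 - 4 * Q₁ / (π * U))) ≤ n)
    (hn₂ : n ≤ (∫ k in -Q₂..Q₂, ρ₂ k) - 2 * Q₂ * (ε₂ / (1 - 4 * Q₂ / (π * U)))) :
    |liebWuEnergyAtFilling U n - (-2 * ∫ k in -Q₁..Q₁, ρ₁ k * Real.cos k)| ≤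
      4 * Q₁ * (ε₁ / (1 - 4 * Q₁ / (π * U))) + 2 / π * (1 + 8 / U) ^ 2 * (Q₂ - Q₁) := by
  have hQ₁π : Q₁ ≤ π := hQ₁₂.trans hQ₂
  have hQ₂0 : 0 < Q₂ := hQ₁.trans_le hQ₁₂
  have hlam₁ : 4 * Q₁ < π * U := by linarith
  have hf₁ := abs_liebWuFillingAtCutoff_sub_le_of_residual hU hQ₁ hQ₁π hlam₁ hρ₁ hres₁
  have hf₂ := abs_liebWuFillingAtCutoff_sub_le_of_residual hU hQ₂0 hQ₂ hlam hρ₂ hres₂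
  have he₁ := abs_liebWuEnergyAtCutoff_sub_le_of_residual hU hQ₁ hQ₁π hlam₁ hρ₁ hres₁
  rw [abs_le] at hf₁ hf₂ he₁
  have hn₁' : liebWuFillingAtCutoff U Q₁ ≤ n := by linarith [hf₁.2]
  have hn₂' : n ≤ liebWuFillingAtCutoff U Q₂ := by linarith [hf₂.1]
  set a := -2 * (∫ k in -Q₁..Q₁, ρ₁ k * Real.cos k) - 4 * Q₁ * (ε₁ / (1 - 4 * Q₁ / (π * U))) with ha
  set b := -2 * (∫ k in -Q₁..Q₁, ρ₁ k * Real.cos k) + 4 * Q₁ * (ε₁ / (1 - 4 * Q₁ / (π * U))) with hb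
  have heab : liebWuEnergyAtCutoff U Q₁ ∈ Icc a b := ⟨by linarith [he₁.1], by linarith [he₁.2]⟩
  obtain ⟨h1, h2⟩ := liebWuEnergyAtFilling_mem_Icc_of_bracket hU hQ₁ hQ₁₂ hQ₂ hn₁' hn₂' heab
  rw [abs_le]
  constructor <;> linarith

end Density

end Literature.MathematicalPhysics.QuantumLattice
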